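import Literature.Computability.QuantumComplexity.CliffordTPathSums
import HarnessLib

/-!
# The Hadamard gadget of Bremner–Jozsa–Shepherd: path variables and the diagonal part

Topic `Literature/Computability/QuantumComplexity`; first file of the discharge of the named
fact `PostBQPWith_subset_PostIQPWith` (`PostBQPToPostIQP.lean`): the **Hadamard gadget** of
Bremner–Jozsa–Shepherd (Proc. R. Soc. A 467 (2011), proof of Thm. 1 with Fig. 1,
arXiv:1005.1407 p. 7), by which every post-selected circuit over `{H} ∪ {diagonal gates}` is
turned into a post-selected IQP circuit `H^{⊗M} D H^{⊗M}` with the same conditional output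
probabilities: "for each intermediate gate `H_a` acting on line `a` we include an extra qubit
line `e` … apply `H_a CZ_{ae} H_e` followed by post-selection of outcome `0` on line `a` … the
resulting state on line `e` is `H|ψ⟩`".

This file is the *combinatorial and algebraic core*, for the tree's Clifford+`T` circuits
(`QCircuit cliffordT N`: gates `H`, `S`, `T`, `CNOT`; `S = T²`, `CNOT_{ct} = H_t CZ_{ct} H_t`):

* `HGadget.DOp` — abstract diagonal IQP operations `Z v`, `T v`, `CZ v w` on **path variables**
  `v ∈ ℕ` (the wires of the eventual IQP circuit), their phases `DOp.phase`, `phaseOf`;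
* `HGadget.St`, `HGadget.step`, `HGadget.run` — the gadget rewriting as a left-to-right pass over
  the gate list: every wire `a` of the circuit has a *current variable* `cur a` (initially `a`);
  an `H` on wire `a` allocates the fresh variable `N + k` (the gadget's extra line `e`), emits
  `CZ (cur a) (N + k)` and sets `cur a := N + k`; `T`/`S` emit `T (cur a)` once/twice; `CNOT_{ct}`
  is `H_t`, `CZ (cur c) (cur t)`, `H_t`; oracle gates (the identity under the empty oracle of
  `QCircuit.mat`) emit nothing;
* bookkeeping (`St.WF`: current variables and emitted operations are allocated, current
  variables are pairwise distinct; `St.WF.run`, `k_le_k_run`);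
* **the path-sum identity** `HGadget.pathSum_final` (with `GInv`, `GInv.run`): for every
  oracle-free gate list `gs`,
  every ambient number of variables `M ≥ N + k` and all basis labels `x y`,
  `2^{N+k} Σ_{u ∈ {0,1}^M, u|_{<N} = x, u ∘ cur = y} Φ(u) = 2^M (√2)^k ⟨y| U_{gs} |x⟩`,
  where `k` is the number of fresh variables, `Φ = phaseOf ops` the product of the emitted
  phases and `U_{gs}` the matrix of the circuit. This is the "easy calculation" of the gadget
  iterated along the circuit: summing the old current variable of an `H` against the sign
  `(-1)^{old·new}` of the emitted `CZ` is one Hadamard transform (`GInv.hadamard`), and diagonal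
  gates read their phase off the current variables (`GInv.diag`).

The IQP circuit proper (`H`-layers, register layout, post-selection and the equality of
conditional probabilities, i.e. `PostBQPWith ε ⊆ PostIQPWith ε` up to uniformity) is assembled
from this identity in the sequel file.

## References

* M. J. Bremner, R. Jozsa, D. J. Shepherd, *Classical simulation of commuting quantum
  computations implies collapse of the polynomial hierarchy*, Proc. R. Soc. A 467 (2011)
  459–472, arXiv:1005.1407: §2.3 (IQP circuits in the `Z`-basis form "each qubit line begins
  and ends with `H`"), Thm. 1 and its proof with Fig. 1 (the Hadamard gadget), p. 7.
* M. A. Nielsen, I. L. Chuang, *Quantum Computation and Quantum Information*, CUP 2010, §4.2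
  (`S = T²`), Ex. 4.20 / §4.3 (`CNOT = (1 ⊗ H) CZ (1 ⊗ H)`).

## Design notes

* Variables are natural numbers and a basis label of the IQP register is read through
  `uAt u v` (`false` beyond the register), so that the rewriting is a total, proof-free program
  on gate lists (the object a uniformity machine prints) and the register size `M` is a
  parameter of the statements only.
* The invariant is stated for an arbitrary matrix `P` multiplied on the left by the gates, with
  entries `P y x`; one-qubit gates act on rows through `sum_ite_agreeOff_eq_sum_bool`.
-/

noncomputable section

namespace Literature.Computability.QuantumComplexity

open _root_.Computability Complexity Cryptography Matrix

namespace HGadget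

variable {N M : ℕ}

/-! ### Abstract diagonal operations on path variables -/

/-- The diagonal IQP operations emitted by the gadget rewriting, on `ℕ`-indexed path variables:
`Z v`, `T v` (phase `ω = e^{iπ/4}`) and `CZ v w`. (BJS 2011, proof of Thm. 1: the resulting
circuit has gates "diagonal in the `Z` basis", here over `{Z, CZ, T}` = the tree's `iqpDiag`.)
[cite: BremnerJozsaShepherdPRSA2011, Thm. 1 (proof)] -/
inductive DOp
  /-- a `Z` gate on variable `v` -/
  | Z (v : ℕ)
  /-- a `T` gate on variable `v` -/
  | T (v : ℕ)
  /-- a `CZ` gate on the variables `v, w` -/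
  | CZ (v w : ℕ)
  deriving DecidableEq, Inhabited

/-- All variables of the operation are `< n` (and the two variables of a `CZ` are distinct, so
that the operation can be placed on wires). [folklore] -/
def DOp.Below (n : ℕ) : DOp → Prop
  | .Z v => v < n
  | .T v => v < n
  | .CZ v w => v < n ∧ w < n ∧ v ≠ w

/-- `Below` is monotone in the bound. [folklore] -/
theorem DOp.Below.mono {n n' : ℕ} (h : n ≤ n') : ∀ {op : DOp}, op.Below n → op.Below n'
  | .Z _, hv => lt_of_lt_of_le hv h
  | .T _, hv => lt_of_lt_of_le hv h
  | .CZ _ _, hv => ⟨lt_of_lt_of_le hv.1 h, lt_of_lt_of_le hv.2.1 h, hv.2.2⟩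

/-- The value of the path variable `v` in the basis label `u ∈ {0,1}^M` (`false` if `v ≥ M`).
[folklore] -/
def uAt (u : QReg M) (v : ℕ) : Bool := if h : v < M then u ⟨v, h⟩ else false

/-- `uAt` at an in-range index. [folklore] -/
theorem uAt_of_lt (u : QReg M) {v : ℕ} (h : v < M) : uAt u v = u ⟨v, h⟩ := dif_pos h

/-- `uAt` at a `Fin M`. [folklore] -/
@[simp] theorem uAt_val (u : QReg M) (w : Fin M) : uAt u w = u w := by
  rw [uAt_of_lt u w.isLt]

/-- The phase `⟨u|op|u⟩` of an abstract diagonal operation at the basis label `u`: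
`(-1)^{u_v}` for `Z v`, `ω^{u_v}` for `T v`, `(-1)^{u_v u_w}` for `CZ v w`.
(Nielsen–Chuang 2010, §4.2–4.3.) [cite: NielsenChuang2010, §4.2] -/
def DOp.phase (U : ℕ → Bool) : DOp → ℂ
  | .Z v => if U v = true then -1 else 1
  | .T v => if U v = true then omega else 1
  | .CZ v w => if U v = true ∧ U w = true then -1 else 1

/-- The phase `⟨u|D|u⟩` of a list of diagonal operations at a valuation `U` of the path
variables: the product of the phases. [folklore] -/
def phaseOf (ops : List DOp) (U : ℕ → Bool) : ℂ := (ops.map (DOp.phase U)).prod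

/-- Phase of the empty list. [folklore] -/
@[simp] theorem phaseOf_nil (U : ℕ → Bool) : phaseOf [] U = 1 := by simp [phaseOf]

/-- Phase of a concatenation. [folklore] -/
theorem phaseOf_append (l l' : List DOp) (U : ℕ → Bool) :
    phaseOf (l ++ l') U = phaseOf l U * phaseOf l' U := by
  simp [phaseOf, List.map_append, List.prod_append]

/-- Phase of a singleton. [folklore] -/
@[simp] theorem phaseOf_singleton (op : DOp) (U : ℕ → Bool) : phaseOf [op] U = op.phase U := by
  simp [phaseOf]

/-- The phase of an operation with variables `< n` only depends on the variables `< n`. [folklore] -/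
theorem DOp.phase_congr {n : ℕ} {op : DOp} (hop : op.Below n) {U U' : ℕ → Bool}
    (h : ∀ v, v < n → U v = U' v) : op.phase U = op.phase U' := by
  cases op with
  | Z v => simp only [DOp.phase, h v hop]
  | T v => simp only [DOp.phase, h v hop]
  | CZ v w => simp only [DOp.phase, h v hop.1, h w hop.2.1]

/-- The phase of a list of operations with variables `< n` only depends on the variables `< n`.
[folklore] -/
theorem phaseOf_congr {n : ℕ} {ops : List DOp} (hops : ∀ op ∈ ops, op.Below n) {U U' : ℕ → Bool}
    (h : ∀ v, v < n → U v = U' v) : phaseOf ops U = phaseOf ops U' := by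
  induction ops with
  | nil => simp
  | cons op ops ih =>
    have h1 : op.Below n := hops op (by simp)
    have h2 : ∀ op' ∈ ops, op'.Below n := fun op' hop' => hops op' (by simp [hop'])
    simp only [phaseOf, List.map_cons, List.prod_cons] at ih ⊢
    rw [DOp.phase_congr h1 h, ih h2]

/-! ### The gadget rewriting -/

/-- The state of the gadget rewriting after a prefix of the circuit: the number `k` of fresh
path variables allocated so far (they are `N, …, N + k - 1`), the current variable `cur a` of
every wire `a`, and the diagonal operations emitted so far (in order of emission).
[cite: BremnerJozsaShepherdPRSA2011, Thm. 1 (proof)] -/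
structure St (N : ℕ) where
  /-- number of fresh variables allocated -/
  k : ℕ
  /-- the current path variable of each wire -/
  cur : Fin N → ℕ
  /-- the emitted diagonal operations -/
  ops : List DOp

/-- The initial state: no fresh variable, wire `a` is its own current variable, nothing emitted.
[folklore] -/
def St.init (N : ℕ) : St N := ⟨0, fun a => a, []⟩

/-- **The Hadamard gadget** on wire `a`: allocate the fresh variable `N + k` (the extra line
`e`), emit `CZ (cur a) (N + k)` and make `N + k` the current variable of `a`.
(BJS 2011, proof of Thm. 1, Fig. 1: `H_a CZ_{ae} H_e` with post-selection of `a`.)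
[cite: BremnerJozsaShepherdPRSA2011, Thm. 1 (proof, Fig. 1)] -/
def St.hadamard (s : St N) (a : Fin N) : St N :=
  ⟨s.k + 1, Function.update s.cur a (N + s.k), s.ops ++ [DOp.CZ (s.cur a) (N + s.k)]⟩

/-- Emit diagonal operations (no new variable). [folklore] -/
def St.emit (s : St N) (l : List DOp) : St N := ⟨s.k, s.cur, s.ops ++ l⟩

/-- One step of the rewriting: `H` ↦ Hadamard gadget; `S` ↦ `T T` and `T` ↦ `T` on the current
variable (`S = T²`); `CNOT_{ct} = H_t CZ_{ct} H_t` ↦ gadget on `t`, `CZ` on the current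
variables of `c, t`, gadget on `t`; oracle gates (the identity under the empty oracle) ↦ nothing.
(BJS 2011, proof of Thm. 1; Nielsen–Chuang 2010, §4.2, Ex. 4.20.)
[cite: BremnerJozsaShepherdPRSA2011, Thm. 1 (proof)] -/
def step (s : St N) : QGate cliffordT N → St N
  | .gate .H e => s.hadamard (embH e 0)
  | .gate .S e => s.emit [DOp.T (s.cur (embS e 0)), DOp.T (s.cur (embS e 0))]
  | .gate .T e => s.emit [DOp.T (s.cur (embT e 0))]
  | .gate .CNOT e =>
      ((s.hadamard (embC e 1)).emit
        [DOp.CZ ((s.hadamard (embC e 1)).cur (embC e 0))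
          ((s.hadamard (embC e 1)).cur (embC e 1))]).hadamard (embC e 1)
  | .oracle _ _ => s

/-- The rewriting of a gate list (head = first gate), from a given state. [folklore] -/
def run : St N → List (QGate cliffordT N) → St N
  | s, [] => s
  | s, g :: gs => run (step s g) gs

/-- `run` on a cons. [folklore] -/
@[simp] theorem run_cons (s : St N) (g : QGate cliffordT N) (gs : List (QGate cliffordT N)) :
    run s (g :: gs) = run (step s g) gs := rfl

/-- `run` on the empty list. [folklore] -/
@[simp] theorem run_nil (s : St N) : run s [] = s := rfl

/-- `run` on a concatenation. [folklore] -/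
theorem run_append (s : St N) (gs gs' : List (QGate cliffordT N)) :
    run s (gs ++ gs') = run (run s gs) gs' := by
  induction gs generalizing s with
  | nil => rfl
  | cons g gs ih => exact ih _

/-! ### Bookkeeping -/

/-- Well-formedness of a state: current variables and emitted operations only use variables
`< N + k`, and distinct wires have distinct current variables. [folklore] -/
structure St.WF (s : St N) : Prop where
  /-- current variables are allocated -/
  cur_lt : ∀ a, s.cur a < N + s.k
  /-- emitted operations use allocated variables -/
  ops_below : ∀ op ∈ s.ops, op.Below (N + s.k)
  /-- distinct wires, distinct current variables -/
  cur_inj : Function.Injective s.cur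

/-- The initial state is well formed. [folklore] -/
theorem St.init_wf (N : ℕ) : (St.init N).WF where
  cur_lt a := by simp [St.init]
  ops_below op h := by simp [St.init] at h
  cur_inj a b h := Fin.ext (by simpa [St.init] using h)

/-- The Hadamard gadget preserves well-formedness. [folklore] -/
theorem St.WF.hadamard {s : St N} (h : s.WF) (a : Fin N) : (s.hadamard a).WF where
  cur_lt b := by
    simp only [St.hadamard]
    rcases eq_or_ne b a with rfl | hb
    · rw [Function.update_self]; omega
    · rw [Function.update_of_ne hb]; exact Nat.lt_succ_of_lt (h.cur_lt b)
  ops_below op hop := by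
    simp only [St.hadamard, List.mem_append, List.mem_singleton] at hop ⊢
    rcases hop with hop | rfl
    · exact (h.ops_below op hop).mono (by omega)
    · exact ⟨Nat.lt_succ_of_lt (h.cur_lt a), by omega, Nat.ne_of_lt (h.cur_lt a)⟩
  cur_inj b c hbc := by
    simp only [St.hadamard] at hbc
    rcases eq_or_ne b a with rfl | hb <;> rcases eq_or_ne c b with rfl | hc
    · rfl
    · rw [Function.update_self, Function.update_of_ne hc] at hbc
      exact absurd hbc.symm (Nat.ne_of_lt (h.cur_lt c))
    · rfl
    · rcases eq_or_ne c a with rfl | hc'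
      · rw [Function.update_self, Function.update_of_ne hb] at hbc
        exact absurd hbc (Nat.ne_of_lt (h.cur_lt b))
      · rw [Function.update_of_ne hb, Function.update_of_ne hc'] at hbc
        exact h.cur_inj hbc

/-- Emitting operations on allocated variables preserves well-formedness. [folklore] -/
theorem St.WF.emit {s : St N} (h : s.WF) {l : List DOp} (hl : ∀ op ∈ l, op.Below (N + s.k)) :
    (s.emit l).WF where
  cur_lt := h.cur_lt
  ops_below op hop := by
    simp only [St.emit, List.mem_append] at hop ⊢
    exact hop.elim (h.ops_below op) (hl op)
  cur_inj := h.cur_inj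

/-- One rewriting step preserves well-formedness. [folklore] -/
theorem St.WF.step {s : St N} (h : s.WF) (g : QGate cliffordT N) : (step s g).WF := by
  cases g with
  | oracle k e => exact h
  | gate g e =>
    cases g with
    | H => exact h.hadamard _
    | S =>
      refine h.emit fun op hop => ?_
      simp only [List.mem_cons, List.not_mem_nil, or_false] at hop
      rcases hop with rfl | rfl <;> exact h.cur_lt _
    | T =>
      refine h.emit fun op hop => ?_
      simp only [List.mem_singleton] at hop
      subst hop; exact h.cur_lt _
    | CNOT =>
      refine ((h.hadamard _).emit fun op hop => ?_).hadamard _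
      simp only [List.mem_singleton] at hop
      subst hop
      exact ⟨(h.hadamard _).cur_lt _, (h.hadamard _).cur_lt _,
        (h.hadamard _).cur_inj.ne (emb_two_ne (embC e))⟩

/-- The rewriting preserves well-formedness. [folklore] -/
theorem St.WF.run {s : St N} (h : s.WF) (gs : List (QGate cliffordT N)) : (run s gs).WF := by
  induction gs generalizing s with
  | nil => exact h
  | cons g gs ih => exact ih (h.step g)

/-- The number of fresh variables does not decrease in a step. [folklore] -/
theorem k_le_k_step (s : St N) (g : QGate cliffordT N) : s.k ≤ (step s g).k := by
  cases g with
  | oracle k e => exact le_rfl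
  | gate g e => cases g <;> simp only [step, St.hadamard, St.emit] <;> omega

/-- The number of fresh variables does not decrease along the rewriting. [folklore] -/
theorem k_le_k_run (s : St N) (gs : List (QGate cliffordT N)) : s.k ≤ (run s gs).k := by
  induction gs generalizing s with
  | nil => exact le_rfl
  | cons g gs ih => exact (k_le_k_step s g).trans (ih _)


/-! ### Sums over basis labels -/

/-- Summing over the labels that agree with `y` off the wire `i` is summing over the bit on `i`.
[folklore] -/
theorem sum_ite_agreeOff_eq_sum_bool (y : QReg N) (i : Fin N) (f : QReg N → ℂ) :
    (∑ y' : QReg N, if (∀ l, l ≠ i → y' l = y l) then f y' else 0) =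
      ∑ b : Bool, f (Function.update y i b) := by
  classical
  rw [← Finset.sum_filter]
  have hset : (Finset.univ.filter fun y' : QReg N => ∀ l, l ≠ i → y' l = y l) =
      Finset.univ.image fun b : Bool => Function.update y i b := by
    ext y'
    simp only [Finset.mem_filter, Finset.mem_univ, true_and, Finset.mem_image]
    constructor
    · intro h
      exact ⟨y' i, (Function.eq_update_iff.2 ⟨rfl, fun l hl => h l hl⟩).symm⟩
    · rintro ⟨b, rfl⟩ l hl
      exact Function.update_of_ne hl _ _
  rw [hset, Finset.sum_image fun b _ c _ h => Function.update_injective _ _ h]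

/-- Entries of a one-qubit gate placed on wire `i`. (Nielsen–Chuang 2010, §4.2.) [folklore] -/
theorem placeGate_wireEmb_apply (i : Fin N) (U : Matrix (QReg 1) (QReg 1) ℂ) (y y' : QReg N) :
    placeGate (wireEmb i) U y y' =
      if (∀ l, l ≠ i → y l = y' l) then U (fun _ => y i) (fun _ => y' i) else 0 := by
  rw [placeGate_apply]
  simp only [range_wireEmb, Set.mem_singleton_iff]
  have h1 : y ∘ wireEmb i = fun _ => y i := funext fun _ => by simp
  have h2 : y' ∘ wireEmb i = fun _ => y' i := funext fun _ => by simp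
  rw [h1, h2]

/-- **Row action of a one-qubit gate**: `(U_i P)(y, x) = Σ_b U(y_i, b) P(y[i ↦ b], x)`.
(Nielsen–Chuang 2010, §4.2.) [folklore] -/
theorem placeGate_wireEmb_mul_apply (i : Fin N) (U : Matrix (QReg 1) (QReg 1) ℂ)
    (P : Matrix (QReg N) (QReg N) ℂ) (y x : QReg N) :
    (placeGate (wireEmb i) U * P) y x =
      ∑ b : Bool, U (fun _ => y i) (fun _ => b) * P (Function.update y i b) x := by
  rw [Matrix.mul_apply]
  have key : ∀ y', placeGate (wireEmb i) U y y' * P y' x =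
      if (∀ l, l ≠ i → y' l = y l) then U (fun _ => y i) (fun _ => y' i) * P y' x else 0 := by
    intro y'
    rw [placeGate_wireEmb_apply]
    by_cases h : ∀ l, l ≠ i → y' l = y l
    · rw [if_pos (fun l hl => (h l hl).symm), if_pos h]
    · rw [if_neg (fun h' => h fun l hl => (h' l hl).symm), if_neg h, zero_mul]
  simp_rw [key]
  rw [sum_ite_agreeOff_eq_sum_bool]
  simp

/-- A one-qubit gate with vanishing off-diagonal entries, placed on wire `i`, is the diagonal
matrix of its diagonal read at bit `i`. (Nielsen–Chuang 2010, §4.2.) [folklore] -/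
theorem placeGate_wireEmb_eq_diagonal (i : Fin N) (U : Matrix (QReg 1) (QReg 1) ℂ)
    (hU : ∀ a b : QReg 1, a ≠ b → U a b = 0) :
    placeGate (wireEmb i) U = Matrix.diagonal fun y : QReg N => U (fun _ => y i) (fun _ => y i) := by
  ext y y'
  rw [placeGate_wireEmb_apply, Matrix.diagonal_apply]
  by_cases hyy : y = y'
  · subst hyy; simp
  · rw [if_neg hyy]
    by_cases h : ∀ l, l ≠ i → y l = y' l
    · rw [if_pos h]
      refine hU _ _ fun hab => hyy (funext fun l => ?_)
      by_cases hl : l = i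
      · subst hl; exact congrFun hab 0
      · exact h l hl
    · rw [if_neg h]

/-- The sign `(-1)^b` as a complex number. [folklore] -/
def bsgn (b : Bool) : ℂ := if b = true then -1 else 1

/-- `(-1)^1 = -1`. [folklore] -/
@[simp] theorem bsgn_true : bsgn true = -1 := rfl

/-- `(-1)^0 = 1`. [folklore] -/
@[simp] theorem bsgn_false : bsgn false = 1 := rfl

/-- Entries of the Hadamard gate: `H(a, b) = (-1)^{ab}/√2`. (Nielsen–Chuang 2010, §1.3.1.) [folklore] -/
theorem hGate_apply_eq (a b : Bool) :
    hGate (fun _ : Fin 1 => a) (fun _ => b) = invSqrt2 * bsgn (a && b) := by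
  cases a <;> cases b <;> simp [hGate, bsgn, invSqrt2]

/-- `√2 ≠ 0` in `ℂ`. [folklore] -/
theorem sqrt2_ne_zero : (Real.sqrt 2 : ℂ) ≠ 0 := by
  rw [Ne, Complex.ofReal_eq_zero]; exact Real.sqrt_ne_zero'.2 (by norm_num)

/-- `√2 · (1/√2) = 1`. [folklore] -/
theorem sqrt2_mul_invSqrt2 : (Real.sqrt 2 : ℂ) * invSqrt2 = 1 := by
  simp only [invSqrt2]
  rw [mul_one_div, div_self sqrt2_ne_zero]

/-- The placed `T` gate is diagonal with phase `ω^{y_i}`. (Nielsen–Chuang 2010, §4.2.) [folklore] -/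
theorem gateT_toMatrix_eq_diagonal (e : Fin (cliffordT.arity CliffordTOp.T) ↪ Fin N) :
    (QGate.gate CliffordTOp.T e : QGate cliffordT N).toMatrix 0 =
      Matrix.diagonal fun y : QReg N => if y (embT e 0) = true then omega else 1 := by
  change placeGate (embT e) tGate = _
  rw [emb_one_eq_wireEmb (embT e), placeGate_wireEmb_eq_diagonal _ _ (fun a b hab => by
    simp [tGate, hab])]
  congr 1; funext y; simp [tGate]

/-- The placed `S` gate is diagonal with phase `i^{y_i}`. (Nielsen–Chuang 2010, §4.2.) [folklore] -/
theorem gateS_toMatrix_eq_diagonal (e : Fin (cliffordT.arity CliffordTOp.S) ↪ Fin N) :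
    (QGate.gate CliffordTOp.S e : QGate cliffordT N).toMatrix 0 =
      Matrix.diagonal fun y : QReg N => if y (embS e 0) = true then Complex.I else 1 := by
  change placeGate (embS e) sGate = _
  rw [emb_one_eq_wireEmb (embS e), placeGate_wireEmb_eq_diagonal _ _ (fun a b hab => by
    simp [sGate, hab])]
  congr 1; funext y; simp [sGate]

/-- The diagonal of `CZ` on the wires `c, t`: `(-1)^{y_c y_t}`. (Nielsen–Chuang 2010, §4.3.) [folklore] -/
def czVec (c t : Fin N) (y : QReg N) : ℂ := bsgn (y c && y t)

/-- The one-bit identity behind `CNOT = (1 ⊗ H) CZ (1 ⊗ H)`: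
`Σ_b H(a,b) (-1)^{cb} H(b,d) = [a = d ⊕ c]`. (Nielsen–Chuang 2010, Ex. 4.20.) [folklore] -/
theorem sum_hGate_czSign_hGate (a c d : Bool) :
    (∑ b : Bool, hGate (fun _ : Fin 1 => a) (fun _ => b) * (bsgn (c && b) *
        hGate (fun _ : Fin 1 => b) (fun _ => d))) = if a = (d ^^ c) then 1 else 0 := by
  have key : ∀ b : Bool, hGate (fun _ : Fin 1 => a) (fun _ => b) * (bsgn (c && b) *
      hGate (fun _ : Fin 1 => b) (fun _ => d)) = 1 / 2 * (bsgn (a && b) * bsgn (c && b) * bsgn (b && d)) := by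
    intro b
    rw [hGate_apply_eq, hGate_apply_eq, ← invSqrt2_mul_invSqrt2]
    ring
  simp only [key, Fintype.sum_bool]
  cases a <;> cases c <;> cases d <;> norm_num

/-- **`CNOT = H_t · CZ · H_t`** for a placed `CNOT` with control `e 0` and target `t = e 1`.
(Nielsen–Chuang 2010, Ex. 4.20 with §4.3; BJS 2011, proof of Thm. 1: only `H` is
non-diagonal.) [cite: NielsenChuang2010, Exercise 4.20] -/
theorem gateCNOT_toMatrix_eq (e : Fin (cliffordT.arity CliffordTOp.CNOT) ↪ Fin N) :
    (QGate.gate CliffordTOp.CNOT e : QGate cliffordT N).toMatrix 0 =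
      placeGate (wireEmb (embC e 1)) hGate * Matrix.diagonal (czVec (embC e 0) (embC e 1)) *
        placeGate (wireEmb (embC e 1)) hGate := by
  have hct : embC e 0 ≠ embC e 1 := emb_two_ne (embC e)
  rw [gateCNOT_eq_cnotOn]
  ext y y'
  -- the left-hand side, read off the column action
  have hL : (cnotOn (embC e 0) (embC e 1) hct).toMatrix 0 y y' =
      if y = Function.update y' (embC e 1) (y' (embC e 1) ^^ y' (embC e 0)) then 1 else 0 := by
    have := congrFun (mulVec_basisState ((cnotOn (embC e 0) (embC e 1) hct).toMatrix 0) y') y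
    rw [← this, cnotOn_mulVec_basisState, basisState_apply]
  rw [hL, Matrix.mul_assoc, placeGate_wireEmb_mul_apply]
  simp_rw [Matrix.diagonal_mul, placeGate_wireEmb_apply]
  simp only [czVec, Function.update_self, Function.update_of_ne hct]
  by_cases hag : ∀ l, l ≠ embC e 1 → y l = y' l
  · have hc : y (embC e 0) = y' (embC e 0) := hag _ hct
    have hin : ∀ b : Bool, (∀ l, l ≠ embC e 1 → Function.update y (embC e 1) b l = y' l) := by
      intro b l hl; rw [Function.update_of_ne hl]; exact hag l hl
    have hin' : ∀ b : Bool, (if (∀ l, l ≠ embC e 1 → Function.update y (embC e 1) b l = y' l)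
        then hGate (fun _ : Fin 1 => b) (fun _ => y' (embC e 1)) else 0) =
          hGate (fun _ : Fin 1 => b) (fun _ => y' (embC e 1)) := fun b => if_pos (hin b)
    simp only [hin']
    rw [sum_hGate_czSign_hGate, hc]
    have hiff : y = Function.update y' (embC e 1) (y' (embC e 1) ^^ y' (embC e 0)) ↔
        y (embC e 1) = (y' (embC e 1) ^^ y' (embC e 0)) := by
      rw [Function.eq_update_iff]; exact ⟨fun h => h.1, fun h => ⟨h, hag⟩⟩
    simp only [hiff]
  · have hout : ∀ b : Bool, ¬ (∀ l, l ≠ embC e 1 → Function.update y (embC e 1) b l = y' l) := by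
      intro b h; exact hag fun l hl => by rw [← h l hl, Function.update_of_ne hl]
    simp only [hout, if_false, mul_zero, Finset.sum_const_zero]
    rw [if_neg]
    intro h
    exact hag fun l hl => by rw [h, Function.update_of_ne hl]

/-! ### Splitting the IQP register and flipping one variable -/

/-- The register of `N + D` path variables as (first `N` variables, last `D` variables). [folklore] -/
def appendEquiv (N D : ℕ) : QReg N × QReg D ≃ QReg (N + D) where
  toFun p := Fin.append p.1 p.2
  invFun u := (fun i => u (Fin.castAdd D i), fun j => u (Fin.natAdd N j))
  left_inv p := by
    ext i
    · simp
    · simp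
  right_inv u := Fin.append_castAdd_natAdd

/-- Flipping the variable `v`. [folklore] -/
def flipAt (v : Fin M) (u : QReg M) : QReg M := Function.update u v (!u v)

/-- Flipping twice is the identity. [folklore] -/
theorem flipAt_flipAt (v : Fin M) (u : QReg M) : flipAt v (flipAt v u) = u := by
  funext w
  by_cases hw : w = v
  · subst hw; simp [flipAt]
  · simp [flipAt, hw]

/-- The flipped variable. [folklore] -/
@[simp] theorem flipAt_apply_self (v : Fin M) (u : QReg M) : flipAt v u v = !u v := by
  simp [flipAt]

/-- The other variables are unchanged. [folklore] -/
theorem flipAt_apply_of_ne (v : Fin M) (u : QReg M) {w : Fin M} (hw : w ≠ v) :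
    flipAt v u w = u w := by
  simp [flipAt, hw]

/-- `uAt` of a flipped label off the flipped variable. [folklore] -/
theorem uAt_flipAt_of_ne (v : Fin M) (u : QReg M) {w : ℕ} (hw : w ≠ v) :
    uAt (flipAt v u) w = uAt u w := by
  by_cases h : w < M
  · rw [uAt_of_lt _ h, uAt_of_lt _ h, flipAt_apply_of_ne]
    exact fun h' => hw (by rw [← h'])
  · simp [uAt, h]

/-- Flipping a variable, as a permutation of the labels. [folklore] -/
def flipEquiv (v : Fin M) : QReg M ≃ QReg M :=
  ⟨flipAt v, flipAt v, flipAt_flipAt v, flipAt_flipAt v⟩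

/-- **Halving**: if the predicate `Q` and the weight `Ψ` do not depend on the variable `v`, then
fixing the value of `v` halves the sum `Σ_{Q} Ψ`. [folklore] -/
theorem two_mul_sum_ite_and_apply_eq (v : Fin M) (β : Bool) (Q : QReg M → Prop) [DecidablePred Q]
    (Ψ : QReg M → ℂ) (hQ : ∀ u, Q (flipAt v u) ↔ Q u) (hΨ : ∀ u, Ψ (flipAt v u) = Ψ u) :
    2 * (∑ u, if Q u ∧ u v = β then Ψ u else 0) = ∑ u, if Q u then Ψ u else 0 := by
  have hsplit : ∀ u, (if Q u then Ψ u else 0) =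
      (if Q u ∧ u v = β then Ψ u else 0) + (if Q u ∧ u v = !β then Ψ u else 0) := by
    intro u
    by_cases hq : Q u
    · cases hu : u v <;> cases β <;> simp [hq]
    · simp [hq]
  have hflip : (∑ u, if Q u ∧ u v = !β then Ψ u else 0) = ∑ u, if Q u ∧ u v = β then Ψ u else 0 := by
    refine Fintype.sum_equiv (flipEquiv v) _ _ fun u => ?_
    show (if Q u ∧ u v = !β then Ψ u else 0) = if Q (flipAt v u) ∧ flipAt v u v = β then Ψ (flipAt v u) else 0
    simp only [hQ, hΨ, flipAt_apply_self]
    cases u v <;> cases β <;> simp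
  simp_rw [hsplit]
  rw [Finset.sum_add_distrib, hflip, two_mul]

/-! ### The path-sum invariant -/

variable {D : ℕ}

/-- The constraint "first variables read `x`, current variables read `y`" on a valuation of the
path variables. [folklore] -/
def Cns (s : St N) (x y : QReg N) (U : ℕ → Bool) : Prop :=
  (∀ a : Fin N, U a = x a) ∧ (∀ a : Fin N, U (s.cur a) = y a)

/-- The constraint is decidable. [folklore] -/
instance (s : St N) (x y : QReg N) : DecidablePred (Cns s x y) := fun U => by
  unfold Cns; infer_instance

/-- The constrained phase sum `Σ_{u : first = x, cur = y} Φ(u)` over the labels of the `N + D`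
path variables. [cite: BremnerJozsaShepherdPRSA2011, Thm. 1 (proof)] -/
def psum (D : ℕ) (s : St N) (x y : QReg N) : ℂ :=
  ∑ u : QReg (N + D), if Cns s x y (uAt u) then phaseOf s.ops (uAt u) else 0

/-- **The gadget invariant** for a matrix `P` and a rewriting state `s` with `k` fresh
variables: `s` is well formed and `2^k Σ_{u : first = x, cur = y} Φ_s(u) = 2^D (√2)^k P(y, x)`
for all labels `x, y`. [cite: BremnerJozsaShepherdPRSA2011, Thm. 1 (proof)] -/
structure GInv (D : ℕ) (P : Matrix (QReg N) (QReg N) ℂ) (s : St N) : Prop where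
  /-- well-formedness of the state -/
  wf : s.WF
  /-- the path-sum identity -/
  sum_eq : ∀ x y : QReg N,
    (2 : ℂ) ^ s.k * psum D s x y = (2 : ℂ) ^ D * (Real.sqrt 2 : ℂ) ^ s.k * P y x

/-- First variables of an appended label. [folklore] -/
theorem uAt_append_castAdd (p : QReg N) (q : QReg D) (a : Fin N) :
    uAt (Fin.append p q) a = p a := by
  rw [uAt_of_lt _ (by omega : (a : ℕ) < N + D)]
  have : (⟨a, by omega⟩ : Fin (N + D)) = Fin.castAdd D a := rfl
  rw [this, Fin.append_left]

/-- **Base case**: the initial state satisfies the invariant for the identity matrix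
(`Σ_{u : first = x = y} 1 = [x = y] 2^D`). [folklore] -/
theorem GInv.init (N D : ℕ) : GInv D (1 : Matrix (QReg N) (QReg N) ℂ) (St.init N) where
  wf := St.init_wf N
  sum_eq x y := by
    simp only [St.init, pow_zero, one_mul, psum, phaseOf_nil, Matrix.one_apply]
    rw [← Fintype.sum_equiv (appendEquiv N D) (fun p => if Cns (St.init N) x y
      (uAt (Fin.append p.1 p.2)) then (1 : ℂ) else 0) _ (fun _ => rfl), Fintype.sum_prod_type]
    simp only [Cns, St.init, uAt_append_castAdd, Finset.sum_const, Finset.card_univ,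
      nsmul_eq_mul, Fintype.card_fun, Fintype.card_bool, Fintype.card_fin]
    have hx : ∀ p : QReg N, ((∀ a, p a = x a) ∧ ∀ a, p a = y a) ↔ (p = x ∧ y = x) := by
      intro p
      constructor
      · rintro ⟨h1, h2⟩
        have hp : p = x := funext h1
        exact ⟨hp, (funext h2).symm.trans hp |>.symm ▸ rfl⟩
      · rintro ⟨rfl, rfl⟩; exact ⟨fun _ => rfl, fun _ => rfl⟩
    simp_rw [hx]
    by_cases hyx : y = x
    · subst hyx
      simp only [and_true, mul_ite, mul_one, mul_zero, Finset.sum_ite_eq', Finset.mem_univ,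
        if_true]
      push_cast; ring
    · simp [hyx]

/-- **Diagonal gates**: multiplying `P` on the left by `diagonal ψ` while emitting operations
whose phase reads `ψ` off the current variables preserves the invariant. (BJS 2011, proof of
Thm. 1: diagonal gates are kept, acting on the current lines.) [cite: BremnerJozsaShepherdPRSA2011, Thm. 1 (proof)] -/
theorem GInv.diag {P : Matrix (QReg N) (QReg N) ℂ} {s : St N} (h : GInv D P s)
    (ψ : QReg N → ℂ) (l : List DOp) (hl : ∀ op ∈ l, op.Below (N + s.k))
    (hφ : ∀ (U : ℕ → Bool) (y : QReg N), (∀ a, U (s.cur a) = y a) → phaseOf l U = ψ y) :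
    GInv D (Matrix.diagonal ψ * P) (s.emit l) where
  wf := h.wf.emit hl
  sum_eq x y := by
    have hk : (s.emit l).k = s.k := rfl
    have hsum : psum D (s.emit l) x y = ψ y * psum D s x y := by
      simp only [psum, St.emit, Finset.mul_sum]
      refine Finset.sum_congr rfl fun u _ => ?_
      by_cases hc : Cns s x y (uAt u)
      · have hc' : Cns (⟨s.k, s.cur, s.ops ++ l⟩ : St N) x y (uAt u) := hc
        rw [if_pos hc', if_pos hc, phaseOf_append, hφ (uAt u) y hc.2, mul_comm]
      · have hc' : ¬ Cns (⟨s.k, s.cur, s.ops ++ l⟩ : St N) x y (uAt u) := hc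
        rw [if_neg hc', if_neg hc, mul_zero]
    rw [hk, hsum, Matrix.diagonal_mul, ← mul_assoc, mul_comm ((2 : ℂ) ^ s.k), mul_assoc,
      h.sum_eq x y]
    ring

/-- **The Hadamard gadget step**: multiplying `P` on the left by `H_a` while performing the
gadget on wire `a` preserves the invariant — summing the old current variable of `a` against
the sign of the emitted `CZ` is a Hadamard transform, and fixing the fresh variable halves the
free sum ("an easy calculation shows that the resulting state on line `e` is `H|ψ⟩`").
[cite: BremnerJozsaShepherdPRSA2011, Thm. 1 (proof, Fig. 1)] -/
theorem GInv.hadamard {P : Matrix (QReg N) (QReg N) ℂ} {s : St N} (h : GInv D P s)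
    (hk : s.k < D) (a : Fin N) :
    GInv D (placeGate (wireEmb a) hGate * P) (s.hadamard a) where
  wf := h.wf.hadamard a
  sum_eq x y := by
    have hwf := h.wf
    -- the fresh variable
    set v : Fin (N + D) := ⟨N + s.k, by omega⟩ with hv
    have hva : ∀ b : Fin N, (b : ℕ) ≠ v := fun b => by simp [hv]; omega
    have hvc : ∀ b : Fin N, s.cur b ≠ v := fun b => by
      have := hwf.cur_lt b; simp [hv]; omega
    -- Step 1: the new constrained sum, split along the old current variable of `a`
    have hstep : ∀ u : QReg (N + D),
        (if Cns (s.hadamard a) x y (uAt u) then phaseOf (s.hadamard a).ops (uAt u) else 0) =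
          ∑ β : Bool, bsgn (β && y a) *
            (if Cns s x (Function.update y a β) (uAt u) ∧ u v = y a
              then phaseOf s.ops (uAt u) else 0) := by
      intro u
      have hops : phaseOf (s.hadamard a).ops (uAt u) =
          phaseOf s.ops (uAt u) * bsgn (uAt u (s.cur a) && uAt u (N + s.k)) := by
        simp only [St.hadamard, phaseOf_append, phaseOf_singleton, DOp.phase, bsgn,
          Bool.and_eq_true]
      have hcns : ∀ β : Bool, (Cns s x (Function.update y a β) (uAt u) ∧ u v = y a) ↔
          (Cns (s.hadamard a) x y (uAt u) ∧ uAt u (s.cur a) = β) := by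
        intro β
        simp only [Cns, St.hadamard]
        constructor
        · rintro ⟨⟨h1, h2⟩, h3⟩
          refine ⟨⟨h1, fun b => ?_⟩, by simpa using h2 a⟩
          rcases eq_or_ne b a with rfl | hb
          · rw [Function.update_self, uAt_of_lt _ (by omega : N + s.k < N + D)]; exact h3
          · rw [Function.update_of_ne hb]; simpa [Function.update_of_ne hb] using h2 b
        · rintro ⟨⟨h1, h2⟩, h3⟩
          refine ⟨⟨h1, fun b => ?_⟩, ?_⟩
          · rcases eq_or_ne b a with rfl | hb
            · rw [Function.update_self]; exact h3
            · rw [Function.update_of_ne hb]; simpa [Function.update_of_ne hb] using h2 b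
          · have := h2 a
            rw [Function.update_self, uAt_of_lt _ (by omega : N + s.k < N + D)] at this
            exact this
      by_cases hc : Cns (s.hadamard a) x y (uAt u)
      · rw [if_pos hc, hops]
        have hva' : uAt u (N + s.k) = y a := by
          have := hc.2 a
          simp only [St.hadamard, Function.update_self] at this
          exact this
        rw [hva']
        cases hβ : uAt u (s.cur a)
        · have ht : ¬ (Cns s x (Function.update y a true) (uAt u) ∧ u v = y a) := fun h' =>
            by have := ((hcns true).1 h').2; rw [hβ] at this; exact Bool.false_ne_true this
          have hf : (Cns s x (Function.update y a false) (uAt u) ∧ u v = y a) :=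
            (hcns false).2 ⟨hc, hβ⟩
          rw [Fintype.sum_bool, if_neg ht, if_pos hf]
          simp only [Bool.false_and, Bool.true_and, bsgn_false, mul_zero, zero_add]
          ring
        · have hf : ¬ (Cns s x (Function.update y a false) (uAt u) ∧ u v = y a) := fun h' =>
            by have := ((hcns false).1 h').2; rw [hβ] at this; exact Bool.false_ne_true this.symm
          have ht : (Cns s x (Function.update y a true) (uAt u) ∧ u v = y a) :=
            (hcns true).2 ⟨hc, hβ⟩
          rw [Fintype.sum_bool, if_pos ht, if_neg hf]
          simp only [Bool.false_and, Bool.true_and, mul_zero, add_zero]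
          ring
      · rw [if_neg hc]
        have hn : ∀ β : Bool, ¬ (Cns s x (Function.update y a β) (uAt u) ∧ u v = y a) :=
          fun β h' => hc ((hcns β).1 h').1
        simp [hn]
    -- Step 2: halving along the fresh variable
    have hhalf : ∀ β : Bool,
        2 * (∑ u : QReg (N + D), if Cns s x (Function.update y a β) (uAt u) ∧ u v = y a
          then phaseOf s.ops (uAt u) else 0) = psum D s x (Function.update y a β) := by
      intro β
      refine two_mul_sum_ite_and_apply_eq v (y a) (fun u => Cns s x (Function.update y a β) (uAt u))
        _ (fun u => ?_) (fun u => ?_)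
      · simp only [Cns, uAt_flipAt_of_ne v u (hva _), uAt_flipAt_of_ne v u (hvc _)]
      · exact phaseOf_congr hwf.ops_below fun w hw => uAt_flipAt_of_ne v u (by
          simp [hv]; omega)
    -- Step 3: assemble
    have hk' : (s.hadamard a).k = s.k + 1 := rfl
    have hL0 : psum D (s.hadamard a) x y = ∑ u : QReg (N + D), ∑ β : Bool, bsgn (β && y a) *
        (if Cns s x (Function.update y a β) (uAt u) ∧ u v = y a
          then phaseOf s.ops (uAt u) else 0) :=
      Finset.sum_congr rfl fun u _ => hstep u
    have hL : (2 : ℂ) ^ (s.k + 1) * psum D (s.hadamard a) x y =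
        ∑ β : Bool, bsgn (β && y a) * ((2 : ℂ) ^ s.k * psum D s x (Function.update y a β)) := by
      rw [hL0, Finset.sum_comm, Finset.mul_sum]
      refine Finset.sum_congr rfl fun β _ => ?_
      rw [← Finset.mul_sum, ← hhalf β]
      ring
    rw [hk', hL]
    simp_rw [h.sum_eq]
    rw [placeGate_wireEmb_mul_apply, Finset.mul_sum]
    refine Finset.sum_congr rfl fun β _ => ?_
    have hpow : (Real.sqrt 2 : ℂ) ^ (s.k + 1) * invSqrt2 = (Real.sqrt 2 : ℂ) ^ s.k := by
      rw [pow_succ, mul_assoc, sqrt2_mul_invSqrt2, mul_one]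
    rw [hGate_apply_eq, Bool.and_comm (y a) β, ← hpow]
    ring


/-! ### One gate, and the whole circuit -/

/-- The matrix of a placed `H` gate. [folklore] -/
theorem gateH_toMatrix_eq (e : Fin (cliffordT.arity CliffordTOp.H) ↪ Fin N) :
    (QGate.gate CliffordTOp.H e : QGate cliffordT N).toMatrix 0 =
      placeGate (wireEmb (embH e 0)) hGate := by
  rw [gateH_eq_hOn]; rfl

/-- `ω · ω = i`. [folklore] -/
theorem omega_mul_omega : omega * omega = Complex.I := by
  rw [← sq, omega_pow_two]

/-- **One rewriting step preserves the invariant**: for an oracle-free gate `g`, if `(P, s)`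
satisfies the invariant and the step does not exceed the `D` available fresh variables, then so
does `(U_g P, step s g)` — `H` by the gadget, `T`/`S` as diagonal gates on the current
variable, `CNOT = H_t CZ H_t` by gadget, `CZ`, gadget.
[cite: BremnerJozsaShepherdPRSA2011, Thm. 1 (proof)] -/
theorem GInv.step {P : Matrix (QReg N) (QReg N) ℂ} {s : St N} (h : GInv D P s)
    {g : QGate cliffordT N} (hg : g.IsOracleFree) (hk : (step s g).k ≤ D) :
    GInv D (g.toMatrix 0 * P) (step s g) := by
  cases g with
  | oracle k e => exact absurd hg id
  | gate g e =>
    cases g with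
    | H =>
      rw [gateH_toMatrix_eq]
      exact h.hadamard (by simpa [HGadget.step, St.hadamard] using hk) _
    | T =>
      rw [gateT_toMatrix_eq_diagonal]
      refine h.diag _ _ (fun op hop => ?_) (fun U y hy => ?_)
      · simp only [List.mem_singleton] at hop
        subst hop; exact h.wf.cur_lt _
      · rw [phaseOf_singleton, DOp.phase, hy]
    | S =>
      rw [gateS_toMatrix_eq_diagonal]
      refine h.diag _ _ (fun op hop => ?_) (fun U y hy => ?_)
      · simp only [List.mem_cons, List.not_mem_nil, or_false] at hop
        rcases hop with rfl | rfl <;> exact h.wf.cur_lt _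
      · simp only [phaseOf, List.map_cons, List.map_nil, List.prod_cons, List.prod_nil, mul_one,
          DOp.phase, hy]
        cases y (embS e 0) <;> simp [omega_mul_omega]
    | CNOT =>
      rw [gateCNOT_toMatrix_eq, Matrix.mul_assoc, Matrix.mul_assoc]
      have hk2 : s.k + 2 ≤ D := by
        have : s.k + 1 + 1 ≤ D := hk
        omega
      have h1 : GInv D (placeGate (wireEmb (embC e 1)) hGate * P) (s.hadamard (embC e 1)) :=
        h.hadamard (by omega) _
      have h2 := h1.diag (czVec (embC e 0) (embC e 1))
        [DOp.CZ ((s.hadamard (embC e 1)).cur (embC e 0)) ((s.hadamard (embC e 1)).cur (embC e 1))]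
        (fun op hop => by
          simp only [List.mem_singleton] at hop
          subst hop
          exact ⟨h1.wf.cur_lt _, h1.wf.cur_lt _, h1.wf.cur_inj.ne (emb_two_ne (embC e))⟩)
        (fun U y hy => by
          rw [phaseOf_singleton, DOp.phase, hy, hy, czVec, bsgn]
          cases y (embC e 0) <;> cases y (embC e 1) <;> simp)
      exact h2.hadamard (by show s.k + 1 < D; omega) _

/-- The matrix of a gate list (first gate rightmost), under the empty oracle. [folklore] -/
abbrev gmat (gs : List (QGate cliffordT N)) : Matrix (QReg N) (QReg N) ℂ :=
  (⟨gs⟩ : QCircuit cliffordT N).toMatrix 0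

/-- **The rewriting preserves the invariant**: running an oracle-free gate list from `(P, s)`
gives `(U_{gs} P, run s gs)`, provided `D` fresh variables suffice.
[cite: BremnerJozsaShepherdPRSA2011, Thm. 1 (proof)] -/
theorem GInv.run {P : Matrix (QReg N) (QReg N) ℂ} {s : St N} (h : GInv D P s)
    (gs : List (QGate cliffordT N)) (hgs : ∀ g ∈ gs, g.IsOracleFree)
    (hk : (run s gs).k ≤ D) : GInv D (gmat gs * P) (run s gs) := by
  induction gs generalizing s P with
  | nil => simpa [gmat] using h
  | cons g gs ih =>
    have hg : g.IsOracleFree := hgs g (by simp)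
    have hgs' : ∀ g' ∈ gs, g'.IsOracleFree := fun g' hg' => hgs g' (by simp [hg'])
    have hk1 : (HGadget.step s g).k ≤ D := (k_le_k_run _ gs).trans hk
    have := ih (h.step hg hk1) hgs' hk
    simpa [gmat, QCircuit.toMatrix_cons, Matrix.mul_assoc] using this

/-- The final state of the gadget rewriting of a gate list. [folklore] -/
def final (gs : List (QGate cliffordT N)) : St N := run (St.init N) gs

/-- The final state is well formed. [folklore] -/
theorem final_wf (gs : List (QGate cliffordT N)) : (final gs).WF := (St.init_wf N).run gs

/-- **The path-sum identity of the Hadamard gadget.** For an oracle-free Clifford+`T` gate list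
`gs` on `N` wires whose rewriting allocates `k ≤ D` fresh path variables, emits the diagonal
operations `ops` and ends with current variables `cur`: for all basis labels `x, y`,
`2^k Σ_{u ∈ {0,1}^{N+D}, u|_{<N} = x, u ∘ cur = y} ⟨u|D_{ops}|u⟩ = 2^D (√2)^k ⟨y|U_{gs}|x⟩`.
[cite: BremnerJozsaShepherdPRSA2011, Thm. 1 (proof: "the same output conditional probabilities")] -/
theorem pathSum_final (gs : List (QGate cliffordT N)) (hgs : ∀ g ∈ gs, g.IsOracleFree)
    (hD : (final gs).k ≤ D) : GInv D (gmat gs) (final gs) := by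
  have h := (GInv.init N D).run gs hgs hD
  rw [Matrix.mul_one] at h
  exact h

end HGadget

end Literature.Computability.QuantumComplexity
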